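import Literature.Topology.FourManifolds.OpenCollar
import Literature.Topology.FourManifolds.GluingConstruction
import Literature.Topology.FourManifolds.InteriorManifold
import Literature.Topology.FourManifolds.SmoothEmbeddingCriteria
import HarnessLib

/-!
# Construction of the gluing `M ∪_φ N` of two manifolds with boundary from open collars

Topic `Literature/Topology/FourManifolds` (fact seat
`provefact-Literature.Topology.FourManifolds.exists_isBoundaryGluing`).  Everything here is proved.

Given smooth `(n+1)`-manifolds with boundary `M`, `N` (model `𝓡∂ (n + 1)`), boundary data `bM`,
`bN` (model `𝓡 n`), a diffeomorphism `φ : ∂M ≅ ∂N` and long open collars `CM : bM.OpenCollar`,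
`CN : bN.OpenCollar` (`OpenCollar.lean`), we construct a smooth manifold without boundary which
*is the gluing of `M` and `N` along `φ`* in the sense of the relational predicate
`Literature.Topology.FourManifolds.IsBoundaryGluing` of `Gluing.lean` (for `M`, `N` compact
Hausdorff).  The construction is Milnor's (*Lectures on the h-cobordism theorem* (1965), proof of
Thm. 1.4; equally Bröcker–Jänich, *Introduction to Differential Topology* (1982), (13.8) and
(13.11), and Hirsch, *Differential Topology* (1976), Ch. 8 §2, "collation from `P`, `Q` and
`U ≅ V × ℝ`"): the glued manifold is the union of the three *open* pieces `M - ∂M`, `N - ∂N`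
(boundaryless manifolds, `InteriorManifold.lean`) and the seam `∂M × ℝ`, in which the collar of
`M` occupies `∂M × [0, ∞)` and the collar of `N` (re-indexed through `φ`) occupies `∂M × (-∞, 0]`;
the pieces are glued along the open collars by two successive open gluings
`Literature.Topology.FourManifolds.SmoothGlueData` (`GluingConstruction.lean`):
`X = (∂M × ℝ) ∪ (M - ∂M)` (`G.d₁.Glued`) and `P = X ∪ (N - ∂N)` (`G.d₂.Glued`).

## Main definitions and results

* `BoundaryData.OpenCollar.glueHomeo C` — the partial diffeomorphism
  `∂M × (0, ∞) ≅ region - ∂M ⊆ M - ∂M` of an open collar; its smoothness; its closed graph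
  (`isClosed_graph_inPt`).
* `InteriorManifold.isImmersionAtOfComplement_of_val_eq` — a map `M → M - ∂M` which is the
  identity on interior points is an immersion at interior points.
* `Literature.Topology.FourManifolds.BoundaryGlueData bM bN` — the input `(CM, CN, φ)`; `G.d₁`, `G.d₂` — the two
  gluing data; instances `T2Space`, `CompactSpace`, `SecondCountableTopology` on `G.d₂.Glued`
  (its `ChartedSpace ℝⁿ⁺¹` and `IsManifold (𝓡 (n + 1)) ∞` structures come from
  `GluingConstruction.lean`).
* `G.jM : M → G.d₂.Glued`, `G.jN : N → G.d₂.Glued` — the two pieces; `isSmoothEmbedding_jM/jN`,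
  `range_jM_union_range_jN`, `jM_eq_jN_iff`.
* `BoundaryGlueData.isBoundaryGluing` — `IsBoundaryGluing bM bN φ (𝓡 (n + 1)) G.d₂.Glued`.
* `sumInlPt`, `sumInrPt`, `isImmersionAtOfComplement_sumInlPt/sumInrPt`,
  `isBoundaryGluing_interiorSum` — the degenerate case of an empty boundary: the interior of the
  disjoint union `M ⊕ N` is the gluing along the empty map.

## References

* J. Milnor, *Lectures on the h-cobordism theorem*, Princeton (1965), §1, Thm. 1.4.
  [MilnorHCobordism1965]
* T. Bröcker, K. Jänich, *Introduction to Differential Topology*, CUP (1982), (13.8), (13.11).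
  [BrockerJanich1982]
* M. W. Hirsch, *Differential Topology*, GTM 33 (1976), Ch. 8 §2. [Hirsch1976]
-/

open scoped Manifold ContDiff Topology
open Set Function Topology

noncomputable section

namespace Literature.Topology.FourManifolds

universe u

/-- Local notation: `𝔼 n` is the model Euclidean space `EuclideanSpace ℝ (Fin n)`. -/
local notation "𝔼 " n:arg => EuclideanSpace ℝ (Fin n)
/-- Local notation: `ℍ n` is the model half-space `EuclideanHalfSpace n`. -/
local notation "ℍ " n:arg => EuclideanHalfSpace n

/-! ### Maps into the interior which are the identity on interior points -/

namespace InteriorManifold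

variable {E H : Type*} [NormedAddCommGroup E] [NormedSpace ℝ E] [TopologicalSpace H]
  {I : ModelWithCorners ℝ E H} {M : Type u} [TopologicalSpace M] [ChartedSpace H M]

open Classical in
/-- The map `M → M - ∂M` which is the identity on interior points (junk value `x₀` on the
boundary). [folklore] -/
def ofPt (x₀ : InteriorManifold I M) (m : M) : InteriorManifold I M :=
  if h : I.IsInteriorPoint m then ⟨m, h⟩ else x₀

/-- On interior points `ofPt x₀` is the identity. [folklore] -/
theorem ofPt_of_isInteriorPoint (x₀ : InteriorManifold I M) {m : M} (h : I.IsInteriorPoint m) :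
    ofPt x₀ m = ⟨m, h⟩ :=
  dif_pos h

/-- On interior points `ofPt x₀` is the identity (value form). [folklore] -/
theorem ofPt_val_of_isInteriorPoint (x₀ : InteriorManifold I M) {m : M}
    (h : I.IsInteriorPoint m) : (ofPt x₀ m).val = m := by
  rw [ofPt_of_isInteriorPoint x₀ h]

variable [IsManifold I ∞ M]

/-- **A map `g : M → M - ∂M` which is the identity on interior points is a `C^∞` immersion at
every interior point** (complement `PUnit`): in the chart `chartAt x` of `M` restricted to the
interior and the chart `interiorChart x` of `M - ∂M` it reads as the identity of `E`. [folklore] -/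
theorem isImmersionAtOfComplement_of_val_eq {g : M → InteriorManifold I M}
    (hg : ∀ m, I.IsInteriorPoint m → (g m).val = m) (x : InteriorManifold I M) :
    Manifold.IsImmersionAtOfComplement PUnit I 𝓘(ℝ, E) ∞ g x.val := by
  set e := chartAt H x.val with he
  have hopen : IsOpen (I.interior M) := isOpen_interior_carrier
  refine Manifold.IsImmersionAtOfComplement.mk_of_charts
    (ContinuousLinearEquiv.prodUnique ℝ E PUnit) (e.restr (I.interior M)) (interiorChart x)
    ?_ ?_ (restr_mem_maximalAtlas _ (IsManifold.chart_mem_maximalAtlas x.val) hopen)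
    (IsManifold.chart_mem_maximalAtlas (I := 𝓘(ℝ, E)) x) ?_ ?_
  · rw [e.restr_source' _ hopen]
    exact ⟨mem_chart_source H x.val, x.property⟩
  · show g x.val ∈ val ⁻¹' (chartAt H x.val).source
    rw [mem_preimage, hg x.val x.property]
    exact mem_chart_source H x.val
  · intro m hm
    rw [e.restr_source' _ hopen] at hm
    show g m ∈ val ⁻¹' (chartAt H x.val).source
    rw [mem_preimage, hg m hm.2]
    exact hm.1
  · intro u hu
    rw [OpenPartialHomeomorph.extend_target] at hu
    obtain ⟨⟨hu₁, hu₂⟩, hu₃⟩ := hu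
    have hu₂' : e.symm (I.symm u) ∈ I.interior M := by
      rw [mem_preimage, hopen.interior_eq] at hu₂
      exact hu₂
    have hut : u ∈ (e.extend I).target := by
      rw [OpenPartialHomeomorph.extend_target]
      exact ⟨hu₁, hu₃⟩
    simp only [comp_apply, OpenPartialHomeomorph.extend_coe, modelWithCornersSelf_coe, id_eq,
      interiorChart_apply, ContinuousLinearEquiv.prodUnique_apply]
    have h1 : ((e.restr (I.interior M)).extend I).symm u = e.symm (I.symm u) := rfl
    rw [h1, hg _ hu₂', ← he]
    exact (e.extend I).right_inv hut

end InteriorManifold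

/-! ### One collar: the partial diffeomorphism `∂M × (0, ∞) ≅ collar` into the interior -/

namespace BoundaryData.OpenCollar

variable {n : ℕ} {M : Type u} [TopologicalSpace M] [ChartedSpace (ℍ (n + 1)) M]
  {b : BoundaryData (𝓡∂ (n + 1)) M (𝓡 n)} (C : b.OpenCollar)

/-- The collar point `toFun x t` as a point of the interior `M - ∂M`, for `t > 0` (junk value
`toFun x 1` for `t ≤ 0`). [folklore] -/
def inPt (p : b.carrier × ℝ) : InteriorManifold (𝓡∂ (n + 1)) M :=
  ⟨C.toFun p.1 (if 0 < p.2 then p.2 else 1),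
    C.isInteriorPoint_apply p.1 (by split_ifs with h; exacts [h, one_pos])⟩

/-- For `t > 0`, `inPt (x, t)` is the collar point `toFun x t`. [folklore] -/
theorem inPt_val {p : b.carrier × ℝ} (hp : 0 < p.2) : (C.inPt p).val = C.toFun p.1 p.2 := by
  simp [inPt, hp]

/-- **The gluing map of a collar**: the partial homeomorphism `(x, t) ↦ toFun x t` from
`∂M × (0, ∞) ⊆ ∂M × ℝ` onto the open subset `region - ∂M` of the interior `M - ∂M`, with inverse
`(proj, height)` (Milnor (1965), proof of Thm. 1.4). [folklore] -/
def glueHomeo : OpenPartialHomeomorph (b.carrier × ℝ) (InteriorManifold (𝓡∂ (n + 1)) M) where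
  toFun := C.inPt
  invFun a := C.projHeight a.val
  source := {p | 0 < p.2}
  target := InteriorManifold.val ⁻¹' C.region
  map_source' p hp := by
    show (C.inPt p).val ∈ C.region
    rw [C.inPt_val hp]
    exact C.mem_region _ _ (le_of_lt hp)
  map_target' a ha := by
    show 0 < C.height a.val
    exact C.height_pos_of_isInteriorPoint ha a.property
  left_inv' p hp := by
    show C.projHeight (C.inPt p).val = p
    rw [C.inPt_val hp, C.projHeight_apply_toFun _ (le_of_lt hp)]
  right_inv' a ha := by
    have h0 : 0 < C.height a.val := C.height_pos_of_isInteriorPoint ha a.property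
    apply InteriorManifold.ext
    rw [projHeight_apply, C.inPt_val h0]
    exact C.apply_proj_height _ ha
  open_source := isOpen_lt continuous_const continuous_snd
  open_target := C.isOpen_region.preimage InteriorManifold.continuous_val
  continuousOn_toFun := by
    rw [InteriorManifold.continuousOn_iff_comp_val]
    refine (C.continuousOn_toFun.mono ?_).congr fun p hp => ?_
    · rintro p hp
      exact ⟨mem_univ _, mem_Ici.2 (le_of_lt hp)⟩
    · exact C.inPt_val hp
  continuousOn_invFun :=
    C.continuousOn_projHeight.comp InteriorManifold.continuous_val.continuousOn fun _ ha => ha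

/-- The source of the gluing map is `∂M × (0, ∞)` (definitional). [folklore] -/
@[simp] theorem glueHomeo_source : C.glueHomeo.source = {p : b.carrier × ℝ | 0 < p.2} := rfl

/-- The target of the gluing map is the part of `region` in the interior (definitional). [folklore] -/
@[simp] theorem glueHomeo_target :
    C.glueHomeo.target = InteriorManifold.val ⁻¹' C.region := rfl

/-- The gluing map is `inPt` (definitional). [folklore] -/
theorem glueHomeo_apply (p : b.carrier × ℝ) : C.glueHomeo p = C.inPt p := rfl

/-- The value of the gluing map in `M`, for `t > 0`. [folklore] -/
theorem glueHomeo_apply_val {p : b.carrier × ℝ} (hp : 0 < p.2) :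
    (C.glueHomeo p).val = C.toFun p.1 p.2 :=
  C.inPt_val hp

/-- The inverse of the gluing map is `(proj, height)` (definitional). [folklore] -/
theorem glueHomeo_symm_apply (a : InteriorManifold (𝓡∂ (n + 1)) M) :
    C.glueHomeo.symm a = C.projHeight a.val := rfl

/-- **The graph of the gluing map of a collar is closed** in `(∂M × ℝ) × (M - ∂M)` (`M`
Hausdorff): it is the trace on `{t ≥ 0}` of the closed equaliser `{toFun x t = a}`, and `t = 0`
is excluded because `toFun x 0 = incl x` is a boundary point. This is the hypothesis of the
Hausdorffness criterion `SmoothGlueData.t2Space_of_isClosed_graph`. [folklore] -/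
theorem isClosed_graph_inPt [T2Space M] :
    IsClosed {q : (b.carrier × ℝ) × InteriorManifold (𝓡∂ (n + 1)) M |
      0 < q.1.2 ∧ C.inPt q.1 = q.2} := by
  set s : Set ((b.carrier × ℝ) × InteriorManifold (𝓡∂ (n + 1)) M) := {q | 0 ≤ q.1.2} with hs
  set f : (b.carrier × ℝ) × InteriorManifold (𝓡∂ (n + 1)) M → M × M :=
    fun q => (uncurry C.toFun q.1, q.2.val) with hf
  have hsc : IsClosed s := isClosed_le continuous_const (continuous_snd.comp continuous_fst)
  have hfc : ContinuousOn f s := by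
    refine ContinuousOn.prodMk ?_ (InteriorManifold.continuous_val.comp_continuousOn continuousOn_snd)
    exact C.continuousOn_toFun.comp continuousOn_fst fun q hq => ⟨mem_univ _, hq⟩
  have hcl : IsClosed (s ∩ f ⁻¹' diagonal M) :=
    hfc.preimage_isClosed_of_isClosed hsc isClosed_diagonal
  convert hcl using 1
  ext ⟨⟨x, t⟩, a⟩
  simp only [mem_setOf_eq, mem_inter_iff, mem_preimage, mem_diagonal_iff, hf, hs, uncurry]
  constructor
  · rintro ⟨ht, rfl⟩
    exact ⟨ht.le, (C.inPt_val (p := (x, t)) ht).symm⟩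
  · rintro ⟨ht, hxa⟩
    have ht' : 0 < t := by
      rcases ht.lt_or_eq with h | h
      · exact h
      · exfalso
        rw [← h, C.apply_zero] at hxa
        exact a.val_notMem_boundary (hxa ▸ b.incl_mem_boundary x)
    exact ⟨ht', InteriorManifold.ext (by rw [C.inPt_val (p := (x, t)) ht']; exact hxa)⟩

variable [IsManifold (𝓡∂ (n + 1)) ∞ M]

/-- The gluing map of a collar is `C^∞` on its source. [folklore] -/
theorem contMDiffOn_glueHomeo :
    ContMDiffOn ((𝓡 n).prod 𝓘(ℝ, ℝ)) 𝓘(ℝ, 𝔼 (n + 1)) ∞ C.glueHomeo C.glueHomeo.source := by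
  rw [InteriorManifold.contMDiffOn_iff_comp_val]
  refine (C.contMDiffOn_toFun.mono ?_).congr fun p hp => ?_
  · rintro p hp
    exact ⟨mem_univ _, mem_Ici.2 (le_of_lt hp)⟩
  · exact C.inPt_val hp

/-- The inverse of the gluing map of a collar is `C^∞` on its target. [folklore] -/
theorem contMDiffOn_glueHomeo_symm :
    ContMDiffOn 𝓘(ℝ, 𝔼 (n + 1)) ((𝓡 n).prod 𝓘(ℝ, ℝ)) ∞ C.glueHomeo.symm C.glueHomeo.target :=
  C.contMDiffOn_projHeight.comp InteriorManifold.contMDiff_val.contMDiffOn fun _ ha => ha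

end BoundaryData.OpenCollar

/-! ### The gluing datum and the two open gluings -/

section Construction

variable {n : ℕ} {M N : Type u}
  [TopologicalSpace M] [ChartedSpace (ℍ (n + 1)) M] [TopologicalSpace N] [ChartedSpace (ℍ (n + 1)) N]

/-- **Gluing datum along the boundary**: long open collars of the boundary data `bM` of `M` and
`bN` of `N`, and the gluing diffeomorphism `φ : ∂M ≅ ∂N` (Milnor (1965), Thm. 1.4;
Bröcker–Jänich (1982), (13.11)). [folklore] -/
structure BoundaryGlueData (bM : BoundaryData (𝓡∂ (n + 1)) M (𝓡 n))
    (bN : BoundaryData (𝓡∂ (n + 1)) N (𝓡 n)) where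
  /-- A long open collar of `∂M`. -/
  CM : bM.OpenCollar
  /-- A long open collar of `∂N`. -/
  CN : bN.OpenCollar
  /-- The gluing diffeomorphism `∂M ≅ ∂N`. -/
  φ : bM.carrier ≃ₘ⟮𝓡 n, 𝓡 n⟯ bN.carrier

namespace BoundaryGlueData

variable {bM : BoundaryData (𝓡∂ (n + 1)) M (𝓡 n)} {bN : BoundaryData (𝓡∂ (n + 1)) N (𝓡 n)}
  (G : BoundaryGlueData bM bN)

/-- The re-indexing homeomorphism of the seam, `(z, t) ↦ (φ z, -t) : ∂M × ℝ ≅ ∂N × ℝ` (the collar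
of `N` runs downwards in the seam). [folklore] -/
def flipφ : bM.carrier × ℝ ≃ₜ bN.carrier × ℝ :=
  G.φ.toHomeomorph.prodCongr (Homeomorph.neg ℝ)

/-- Formula for `flipφ` (definitional). [folklore] -/
@[simp] theorem flipφ_apply (p : bM.carrier × ℝ) : G.flipφ p = (G.φ p.1, -p.2) := rfl

/-- Formula for `flipφ⁻¹` (definitional). [folklore] -/
@[simp] theorem flipφ_symm_apply (q : bN.carrier × ℝ) :
    G.flipφ.symm q = (G.φ.symm q.1, -q.2) := rfl

/-- `flipφ` is smooth. [folklore] -/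
theorem contMDiff_flipφ :
    ContMDiff ((𝓡 n).prod 𝓘(ℝ, ℝ)) ((𝓡 n).prod 𝓘(ℝ, ℝ)) ∞ G.flipφ :=
  G.φ.contMDiff.prodMap contDiff_neg.contMDiff

/-- `flipφ⁻¹` is smooth. [folklore] -/
theorem contMDiff_flipφ_symm :
    ContMDiff ((𝓡 n).prod 𝓘(ℝ, ℝ)) ((𝓡 n).prod 𝓘(ℝ, ℝ)) ∞ G.flipφ.symm :=
  G.φ.symm.contMDiff.prodMap contDiff_neg.contMDiff

variable [IsManifold (𝓡∂ (n + 1)) ∞ M]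

/-- **First gluing datum**: the seam `∂M × ℝ` and the interior `M - ∂M`, glued along the collar of
`M` on `∂M × (0, ∞)`; model vector spaces identified with `ℝⁿ⁺¹` by `consCLE` and the identity.
The first glued manifold `X = (∂M × ℝ) ∪ (M - ∂M)` is `G.d₁.Glued`. [folklore] -/
def d₁ : SmoothGlueData ((𝓡 n).prod 𝓘(ℝ, ℝ)) 𝓘(ℝ, 𝔼 (n + 1)) (bM.carrier × ℝ)
    (InteriorManifold (𝓡∂ (n + 1)) M) (𝔼 (n + 1)) where
  glue := G.CM.glueHomeo
  contMDiffOn_glue := G.CM.contMDiffOn_glueHomeo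
  contMDiffOn_glue_symm := G.CM.contMDiffOn_glueHomeo_symm
  linA := BoundaryManifold.consCLE n
  linB := ContinuousLinearEquiv.refl ℝ _

/-- The gluing map of `d₁` is the gluing map of the collar of `M` (definitional). [folklore] -/
theorem d₁_glue : G.d₁.glue = G.CM.glueHomeo := rfl

/-- `X` is Hausdorff (`M` Hausdorff): the graph of the collar gluing map is closed. [folklore] -/
instance instT2SpaceGlued₁ [T2Space M] : T2Space G.d₁.Glued := by
  haveI : T2Space bM.carrier := bM.isSmoothEmbedding.isEmbedding.t2Space
  exact G.d₁.t2Space_of_isClosed_graph G.CM.isClosed_graph_inPt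

variable [Nonempty bM.carrier]

/-- The seam `∂M × ℝ` as an open partial homeomorphism onto its (open) image `inl (∂M × ℝ) ⊆ X`.
[folklore] -/
def seam : OpenPartialHomeomorph (bM.carrier × ℝ) G.d₁.Glued :=
  G.d₁.isOpenEmbedding_inl.toOpenPartialHomeomorph G.d₁.inl

/-- The seam embedding is `inl` (definitional). [folklore] -/
@[simp] theorem seam_apply (p : bM.carrier × ℝ) : G.seam p = G.d₁.inl p := rfl

/-- The source of the seam embedding is everything (definitional). [folklore] -/
@[simp] theorem seam_source : G.seam.source = univ := rfl

/-- The target of the seam embedding is `range inl`. [folklore] -/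
theorem seam_target : G.seam.target = range G.d₁.inl :=
  G.d₁.isOpenEmbedding_inl.toOpenPartialHomeomorph_target _

/-- The seam embedding inverts `inl`. [folklore] -/
theorem seam_symm_inl (p : bM.carrier × ℝ) : G.seam.symm (G.d₁.inl p) = p :=
  G.d₁.isOpenEmbedding_inl.toOpenPartialHomeomorph_left_inv

/-- The inverse of the seam embedding is smooth on `inl (∂M × ℝ)`. [folklore] -/
theorem contMDiffOn_seam_symm :
    ContMDiffOn 𝓘(ℝ, 𝔼 (n + 1)) ((𝓡 n).prod 𝓘(ℝ, ℝ)) ∞ G.seam.symm (range G.d₁.inl) :=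
  contMDiffOn_symm_of_isSmoothEmbedding G.d₁.isSmoothEmbedding_inl G.d₁.isOpenEmbedding_inl

/-- **The second gluing map** `X ⊇ inl (∂M × (-∞, 0)) → N - ∂N`, `inl (z, t) ↦ CN (φ z) (-t)`:
the seam inverted, re-indexed by `flipφ`, followed by the gluing map of the collar of `N`. [folklore] -/
def glue₂ : OpenPartialHomeomorph G.d₁.Glued (InteriorManifold (𝓡∂ (n + 1)) N) :=
  G.seam.symm ≫ₕ (G.flipφ.toOpenPartialHomeomorph ≫ₕ G.CN.glueHomeo)

/-- Formula for `glue₂` (definitional). [folklore] -/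
theorem glue₂_apply (x : G.d₁.Glued) : G.glue₂ x = G.CN.inPt (G.flipφ (G.seam.symm x)) := rfl

/-- `glue₂ (inl (z, t)) = CN (φ z) (-t)`. [folklore] -/
theorem glue₂_inl (p : bM.carrier × ℝ) : G.glue₂ (G.d₁.inl p) = G.CN.inPt (G.φ p.1, -p.2) := by
  rw [glue₂_apply, seam_symm_inl, flipφ_apply]

/-- The source of `glue₂` is `inl (∂M × (-∞, 0))`. [folklore] -/
theorem mem_glue₂_source_iff {x : G.d₁.Glued} :
    x ∈ G.glue₂.source ↔ ∃ p : bM.carrier × ℝ, p.2 < 0 ∧ G.d₁.inl p = x := by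
  have hsrc : G.glue₂.source = range G.d₁.inl ∩ {x | 0 < -(G.seam.symm x).2} := by
    rw [glue₂, OpenPartialHomeomorph.trans_source, OpenPartialHomeomorph.symm_source, seam_target,
      OpenPartialHomeomorph.trans_source, Homeomorph.toOpenPartialHomeomorph_source, univ_inter]
    rfl
  rw [hsrc]
  constructor
  · rintro ⟨⟨p, rfl⟩, hp⟩
    rw [mem_setOf_eq, seam_symm_inl, Left.neg_pos_iff] at hp
    exact ⟨p, hp, rfl⟩
  · rintro ⟨p, hp, rfl⟩
    refine ⟨mem_range_self p, ?_⟩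
    rw [mem_setOf_eq, seam_symm_inl, Left.neg_pos_iff]
    exact hp

/-- `inl p` lies in the source of `glue₂` iff `p.2 < 0`. [folklore] -/
theorem inl_mem_glue₂_source_iff {p : bM.carrier × ℝ} :
    G.d₁.inl p ∈ G.glue₂.source ↔ p.2 < 0 := by
  rw [mem_glue₂_source_iff]
  constructor
  · rintro ⟨q, hq, hqp⟩
    rwa [G.d₁.inl_injective hqp] at hq
  · exact fun hp => ⟨p, hp, rfl⟩

/-- Formula for `glue₂⁻¹` (definitional). [folklore] -/
theorem glue₂_symm_apply (c : InteriorManifold (𝓡∂ (n + 1)) N) :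
    G.glue₂.symm c = G.d₁.inl (G.φ.symm (G.CN.proj c.val), -G.CN.height c.val) := rfl

/-- The target of `glue₂` is the part of the collar region of `N` in the interior. [folklore] -/
theorem mem_glue₂_target_iff {c : InteriorManifold (𝓡∂ (n + 1)) N} :
    c ∈ G.glue₂.target ↔ c.val ∈ G.CN.region := by
  simp only [glue₂, OpenPartialHomeomorph.trans_target, OpenPartialHomeomorph.symm_target,
    seam_source, Homeomorph.toOpenPartialHomeomorph_target, mem_preimage, preimage_univ,
    inter_univ, BoundaryData.OpenCollar.glueHomeo_target]

variable [IsManifold (𝓡∂ (n + 1)) ∞ N]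

/-- The second gluing map is smooth on its source. [folklore] -/
theorem contMDiffOn_glue₂ :
    ContMDiffOn 𝓘(ℝ, 𝔼 (n + 1)) 𝓘(ℝ, 𝔼 (n + 1)) ∞ G.glue₂ G.glue₂.source := by
  have h1 : ContMDiffOn 𝓘(ℝ, 𝔼 (n + 1)) ((𝓡 n).prod 𝓘(ℝ, ℝ)) ∞ (G.flipφ ∘ G.seam.symm)
      G.glue₂.source :=
    G.contMDiff_flipφ.comp_contMDiffOn (G.contMDiffOn_seam_symm.mono fun x hx => by
      rw [← seam_target]; exact hx.1)
  refine (G.CN.contMDiffOn_glueHomeo.comp h1 fun x hx => ?_).congr fun x _ => rfl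
  exact hx.2.2

/-- The inverse of the second gluing map is smooth on its target. [folklore] -/
theorem contMDiffOn_glue₂_symm :
    ContMDiffOn 𝓘(ℝ, 𝔼 (n + 1)) 𝓘(ℝ, 𝔼 (n + 1)) ∞ G.glue₂.symm G.glue₂.target := by
  have h1 : ContMDiffOn 𝓘(ℝ, 𝔼 (n + 1)) ((𝓡 n).prod 𝓘(ℝ, ℝ)) ∞
      (G.flipφ.symm ∘ G.CN.glueHomeo.symm) G.glue₂.target :=
    G.contMDiff_flipφ_symm.comp_contMDiffOn (G.CN.contMDiffOn_glueHomeo_symm.mono fun c hc =>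
      G.mem_glue₂_target_iff.1 hc)
  exact (G.d₁.contMDiff_inl.comp_contMDiffOn h1).congr fun c _ => rfl

/-- **Second gluing datum**: `X` and the interior `N - ∂N`, glued along `glue₂`. The glued manifold
`P = M ∪_φ N = X ∪ (N - ∂N)` is `G.d₂.Glued`, a `C^∞` manifold modelled on `ℝⁿ⁺¹`
(`GluingConstruction.lean`). [folklore] -/
def d₂ : SmoothGlueData 𝓘(ℝ, 𝔼 (n + 1)) 𝓘(ℝ, 𝔼 (n + 1)) G.d₁.Glued
    (InteriorManifold (𝓡∂ (n + 1)) N) (𝔼 (n + 1)) where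
  glue := G.glue₂
  contMDiffOn_glue := G.contMDiffOn_glue₂
  contMDiffOn_glue_symm := G.contMDiffOn_glue₂_symm
  linA := ContinuousLinearEquiv.refl ℝ _
  linB := ContinuousLinearEquiv.refl ℝ _

/-- The gluing map of `d₂` is `glue₂` (definitional). [folklore] -/
theorem d₂_glue : G.d₂.glue = G.glue₂ := rfl

/-- **`P` is Hausdorff** (`M`, `N` Hausdorff). The graph of `glue₂` is the image under the
embedding `inl × id` of the closed graph of `flipφ ≫ glueHomeo_N`, and its closure stays inside
`inl (∂M × ℝ) × (N - ∂N)` because a point of `inr (M - ∂M)` has the neighbourhood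
`inr (M - ∂M) × (N - ∂N)`, which misses the graph (on it the seam parameter is positive). [folklore] -/
instance instT2SpaceGlued₂ [T2Space M] [T2Space N] : T2Space G.d₂.Glued := by
  haveI : T2Space bM.carrier := bM.isSmoothEmbedding.isEmbedding.t2Space
  refine G.d₂.t2Space_of_isClosed_graph ?_
  -- the graph upstairs and the embedding
  set ι : (bM.carrier × ℝ) × InteriorManifold (𝓡∂ (n + 1)) N →
      G.d₁.Glued × InteriorManifold (𝓡∂ (n + 1)) N := Prod.map G.d₁.inl id with hι
  have hιe : IsEmbedding ι := G.d₁.isOpenEmbedding_inl.isEmbedding.prodMap IsEmbedding.id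
  set F' : Set ((bM.carrier × ℝ) × InteriorManifold (𝓡∂ (n + 1)) N) :=
    {q | 0 < (G.flipφ q.1).2 ∧ G.CN.inPt (G.flipφ q.1) = q.2} with hF'
  have hF'c : IsClosed F' :=
    G.CN.isClosed_graph_inPt.preimage (G.flipφ.continuous.prodMap continuous_id)
  have hFeq : {p : G.d₁.Glued × InteriorManifold (𝓡∂ (n + 1)) N |
      p.1 ∈ G.d₂.glue.source ∧ G.d₂.glue p.1 = p.2} = ι '' F' := by
    ext ⟨x, c⟩
    constructor
    · rintro ⟨hx, hxc⟩
      obtain ⟨p, hp, rfl⟩ := G.mem_glue₂_source_iff.1 hx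
      refine ⟨(p, c), ⟨?_, ?_⟩, rfl⟩
      · show 0 < (G.flipφ p).2
        rw [flipφ_apply]
        exact Left.neg_pos_iff.2 hp
      · show G.CN.inPt (G.flipφ p) = c
        rw [flipφ_apply, ← G.glue₂_inl p]
        exact hxc
    · rintro ⟨⟨p, c'⟩, ⟨hp, hc'⟩, hq⟩
      simp only [hι, Prod.map_apply, id_eq, Prod.mk.injEq] at hq
      obtain ⟨rfl, rfl⟩ := hq
      rw [flipφ_apply] at hp
      exact ⟨G.inl_mem_glue₂_source_iff.2 (Left.neg_pos_iff.1 hp), (G.glue₂_inl p).trans hc'⟩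
  rw [hFeq]
  -- closure of the image stays in the range of `ι`
  have hV : IsOpen ((range G.d₁.inr) ×ˢ (univ : Set (InteriorManifold (𝓡∂ (n + 1)) N))) :=
    G.d₁.isOpen_range_inr.prod isOpen_univ
  have hsub : ι '' F' ⊆ ((range G.d₁.inr) ×ˢ univ)ᶜ := by
    rintro _ ⟨⟨p, c⟩, ⟨hp, -⟩, rfl⟩ ⟨hx, -⟩
    have h' : p ∈ G.d₁.glue.source := G.d₁.inl_mem_range_inr_iff.1 hx
    have h'' : 0 < p.2 := h'
    rw [flipφ_apply] at hp
    have hp' : p.2 < 0 := Left.neg_pos_iff.1 hp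
    linarith
  have hcl : closure (ι '' F') ⊆ range ι := by
    intro q hq
    have hq' : q ∈ ((range G.d₁.inr) ×ˢ (univ : Set (InteriorManifold (𝓡∂ (n + 1)) N)))ᶜ :=
      (closure_minimal hsub hV.isClosed_compl) hq
    have hq1 : q.1 ∉ range G.d₁.inr := fun h => hq' ⟨h, mem_univ _⟩
    obtain ⟨p, hp⟩ := (G.d₁.exists_inl_or_inr q.1).resolve_right fun ⟨a, ha⟩ => hq1 ⟨a, ha⟩
    exact ⟨(p, q.2), Prod.ext hp rfl⟩
  refine isClosed_of_closure_subset fun q hq => ?_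
  obtain ⟨q', rfl⟩ := hcl hq
  have hq'' : q' ∈ closure F' := by
    rw [hιe.closure_eq_preimage_closure_image]
    exact hq
  rw [hF'c.closure_eq] at hq''
  exact mem_image_of_mem ι hq''

/-! ### The two pieces `M → P`, `N → P` -/

open Classical in
/-- **The first piece** `j_M : M → P`: on the collar region `a ↦ inl (inl (proj a, height a))`
(the seam coordinates), elsewhere `a ↦ inl (inr a)` (the interior); the two formulas agree on
the overlap by the first gluing relation (`jM_of_isInteriorPoint`). [folklore] -/
def jM (a : M) : G.d₂.Glued :=
  if h : a ∈ G.CM.region then G.d₂.inl (G.d₁.inl (G.CM.projHeight a))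
  else G.d₂.inl (G.d₁.inr ⟨a, G.CM.isInteriorPoint_of_not_mem_region h⟩)

/-- `j_M` on the collar region. [folklore] -/
theorem jM_of_mem_region {a : M} (h : a ∈ G.CM.region) :
    G.jM a = G.d₂.inl (G.d₁.inl (G.CM.projHeight a)) :=
  dif_pos h

omit [Nonempty bM.carrier] [IsManifold (𝓡∂ (n + 1)) ∞ N] in
/-- The first gluing relation: an interior point of the collar region has the same image
through the seam and through the interior. [folklore] -/
theorem inl_projHeight_eq_inr {a : M} (h : a ∈ G.CM.region)
    (ha : (𝓡∂ (n + 1)).IsInteriorPoint a) :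
    G.d₁.inl (G.CM.projHeight a) = G.d₁.inr ⟨a, ha⟩ := by
  have h0 : 0 < G.CM.height a := G.CM.height_pos_of_isInteriorPoint h ha
  rw [G.d₁.inl_eq_inr_iff]
  refine ⟨h0, ?_⟩
  apply InteriorManifold.ext
  show (G.CM.inPt (G.CM.projHeight a)).val = a
  rw [G.CM.inPt_val (p := G.CM.projHeight a) h0]
  exact G.CM.apply_proj_height a h

/-- `j_M` on interior points. [folklore] -/
theorem jM_of_isInteriorPoint {a : M} (ha : (𝓡∂ (n + 1)).IsInteriorPoint a) :
    G.jM a = G.d₂.inl (G.d₁.inr ⟨a, ha⟩) := by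
  by_cases h : a ∈ G.CM.region
  · rw [G.jM_of_mem_region h, G.inl_projHeight_eq_inr h ha]
  · exact dif_neg h

/-- `j_M` on the boundary: `j_M (incl z) = inl (inl (z, 0))`. [folklore] -/
theorem jM_incl (z : bM.carrier) : G.jM (bM.incl z) = G.d₂.inl (G.d₁.inl (z, 0)) := by
  rw [G.jM_of_mem_region (G.CM.incl_mem_region z), BoundaryData.OpenCollar.projHeight_apply,
    G.CM.proj_incl, G.CM.height_incl]

/-- `j_M` on the collar: `j_M (CM z t) = inl (inl (z, t))` for `t ≥ 0`. [folklore] -/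
theorem jM_toFun (z : bM.carrier) {t : ℝ} (ht : 0 ≤ t) :
    G.jM (G.CM.toFun z t) = G.d₂.inl (G.d₁.inl (z, t)) := by
  rw [G.jM_of_mem_region (G.CM.mem_region z t ht), G.CM.projHeight_apply_toFun z ht]

open Classical in
/-- **The second piece** `j_N : N → P`: on the collar region `c ↦ inl (inl (φ⁻¹ (proj c), -height c))`
(the seam coordinates, downwards), elsewhere `c ↦ inr c` (the interior); the two formulas agree
on the overlap by the second gluing relation (`jN_of_isInteriorPoint`). [folklore] -/
def jN (c : N) : G.d₂.Glued :=
  if h : c ∈ G.CN.region then G.d₂.inl (G.d₁.inl (G.φ.symm (G.CN.proj c), -G.CN.height c))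
  else G.d₂.inr ⟨c, G.CN.isInteriorPoint_of_not_mem_region h⟩

/-- `j_N` on the collar region. [folklore] -/
theorem jN_of_mem_region {c : N} (h : c ∈ G.CN.region) :
    G.jN c = G.d₂.inl (G.d₁.inl (G.φ.symm (G.CN.proj c), -G.CN.height c)) :=
  dif_pos h

/-- The second gluing relation: an interior point of the collar region of `N` has the same image
through the seam and through the interior of `N`. [folklore] -/
theorem inl_inl_eq_inr {c : N} (h : c ∈ G.CN.region) (hc : (𝓡∂ (n + 1)).IsInteriorPoint c) :
    G.d₂.inl (G.d₁.inl (G.φ.symm (G.CN.proj c), -G.CN.height c)) = G.d₂.inr ⟨c, hc⟩ := by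
  have h0 : 0 < G.CN.height c := G.CN.height_pos_of_isInteriorPoint h hc
  rw [G.d₂.inl_eq_inr_iff, d₂_glue]
  refine ⟨G.inl_mem_glue₂_source_iff.2 (by simpa using h0), ?_⟩
  rw [G.glue₂_inl]
  apply InteriorManifold.ext
  rw [G.CN.inPt_val (p := (G.φ (G.φ.symm (G.CN.proj c)), - -G.CN.height c)) (by simpa using h0)]
  simp only [Diffeomorph.apply_symm_apply, neg_neg]
  exact G.CN.apply_proj_height c h

/-- `j_N` on interior points. [folklore] -/
theorem jN_of_isInteriorPoint {c : N} (hc : (𝓡∂ (n + 1)).IsInteriorPoint c) :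
    G.jN c = G.d₂.inr ⟨c, hc⟩ := by
  by_cases h : c ∈ G.CN.region
  · rw [G.jN_of_mem_region h, G.inl_inl_eq_inr h hc]
  · exact dif_neg h

/-- `j_N` on the boundary: `j_N (incl w) = inl (inl (φ⁻¹ w, 0))`. [folklore] -/
theorem jN_incl (w : bN.carrier) : G.jN (bN.incl w) = G.d₂.inl (G.d₁.inl (G.φ.symm w, 0)) := by
  rw [G.jN_of_mem_region (G.CN.incl_mem_region w), G.CN.proj_incl, G.CN.height_incl, neg_zero]

/-- `j_N` on the collar: `j_N (CN (φ z) s) = inl (inl (z, -s))` for `s ≥ 0`. [folklore] -/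
theorem jN_toFun (z : bM.carrier) {s : ℝ} (hs : 0 ≤ s) :
    G.jN (G.CN.toFun (G.φ z) s) = G.d₂.inl (G.d₁.inl (z, -s)) := by
  rw [G.jN_of_mem_region (G.CN.mem_region _ s hs), G.CN.proj_apply _ s hs,
    G.CN.height_apply _ s hs, Diffeomorph.symm_apply_apply]

/-! ### The pieces are immersions -/

/-- **`j_M` is a `C^∞` immersion** at every point (complement `PUnit`): on the collar region it is
`inl ∘ inl ∘ (proj, height)`, an immersion by `OpenCollar.isImmersionAtOfComplement_projHeight`
and "`inl ∘ g` is an immersion where `g` is" (twice); at interior points it is `inl ∘ inr ∘ ofPt`.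
[folklore] -/
theorem isImmersionAtOfComplement_jM (a : M) :
    Manifold.IsImmersionAtOfComplement PUnit.{1} (𝓡∂ (n + 1)) 𝓘(ℝ, 𝔼 (n + 1)) ∞ G.jM a := by
  by_cases h : a ∈ G.CM.region
  · have h1 := G.d₂.isImmersionAtOfComplement_inl_comp
      (G.d₁.isImmersionAtOfComplement_inl_comp (G.CM.isImmersionAtOfComplement_projHeight h))
    refine h1.congr_of_eventuallyEq ?_
    filter_upwards [G.CM.isOpen_region.mem_nhds h] with a' ha'
    exact (G.jM_of_mem_region ha').symm
  · have ha : (𝓡∂ (n + 1)).IsInteriorPoint a := G.CM.isInteriorPoint_of_not_mem_region h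
    set x₀ : InteriorManifold (𝓡∂ (n + 1)) M := ⟨a, ha⟩
    have h1 := G.d₂.isImmersionAtOfComplement_inl_comp
      (G.d₁.isImmersionAtOfComplement_inr_comp
        (InteriorManifold.isImmersionAtOfComplement_of_val_eq
          (g := InteriorManifold.ofPt x₀)
          (fun m hm => InteriorManifold.ofPt_val_of_isInteriorPoint x₀ hm) x₀))
    refine h1.congr_of_eventuallyEq ?_
    filter_upwards [InteriorManifold.isOpen_interior_carrier.mem_nhds ha] with a' ha'
    show G.d₂.inl (G.d₁.inr (InteriorManifold.ofPt x₀ a')) = G.jM a'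
    rw [InteriorManifold.ofPt_of_isInteriorPoint x₀ ha', G.jM_of_isInteriorPoint ha']

/-- **`j_N` is a `C^∞` immersion** at every point: on the collar region it is
`inl ∘ inl ∘ (φ⁻¹ ∘ proj, -height)` (`OpenCollar.isImmersionAtOfComplement_reindexNeg`), at
interior points `inr ∘ ofPt`. [folklore] -/
theorem isImmersionAtOfComplement_jN (c : N) :
    Manifold.IsImmersionAtOfComplement PUnit.{1} (𝓡∂ (n + 1)) 𝓘(ℝ, 𝔼 (n + 1)) ∞ G.jN c := by
  by_cases h : c ∈ G.CN.region
  · have h1 := G.d₂.isImmersionAtOfComplement_inl_comp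
      (G.d₁.isImmersionAtOfComplement_inl_comp (G.CN.isImmersionAtOfComplement_reindexNeg G.φ.symm h))
    refine h1.congr_of_eventuallyEq ?_
    filter_upwards [G.CN.isOpen_region.mem_nhds h] with c' hc'
    exact (G.jN_of_mem_region hc').symm
  · have hc : (𝓡∂ (n + 1)).IsInteriorPoint c := G.CN.isInteriorPoint_of_not_mem_region h
    set y₀ : InteriorManifold (𝓡∂ (n + 1)) N := ⟨c, hc⟩
    have h1 := G.d₂.isImmersionAtOfComplement_inr_comp
      (InteriorManifold.isImmersionAtOfComplement_of_val_eq (g := InteriorManifold.ofPt y₀)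
        (fun m hm => InteriorManifold.ofPt_val_of_isInteriorPoint y₀ hm) y₀)
    refine h1.congr_of_eventuallyEq ?_
    filter_upwards [InteriorManifold.isOpen_interior_carrier.mem_nhds hc] with c' hc'
    show G.d₂.inr (InteriorManifold.ofPt y₀ c') = G.jN c'
    rw [InteriorManifold.ofPt_of_isInteriorPoint y₀ hc', G.jN_of_isInteriorPoint hc']

/-- `j_M` is a `C^∞` immersion. [folklore] -/
theorem isImmersion_jM : Manifold.IsImmersion (𝓡∂ (n + 1)) 𝓘(ℝ, 𝔼 (n + 1)) ∞ G.jM :=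
  Manifold.IsImmersionOfComplement.isImmersion (F := PUnit.{1}) fun a => G.isImmersionAtOfComplement_jM a

/-- `j_N` is a `C^∞` immersion. [folklore] -/
theorem isImmersion_jN : Manifold.IsImmersion (𝓡∂ (n + 1)) 𝓘(ℝ, 𝔼 (n + 1)) ∞ G.jN :=
  Manifold.IsImmersionOfComplement.isImmersion (F := PUnit.{1}) fun c => G.isImmersionAtOfComplement_jN c

/-- `j_M` is continuous. [folklore] -/
theorem continuous_jM : Continuous G.jM := G.isImmersion_jM.contMDiff.continuous

/-- `j_N` is continuous. [folklore] -/
theorem continuous_jN : Continuous G.jN := G.isImmersion_jN.contMDiff.continuous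

/-! ### Fibres of the pieces -/

omit [IsManifold (𝓡∂ (n + 1)) ∞ M] [Nonempty bM.carrier] [IsManifold (𝓡∂ (n + 1)) ∞ N] in
/-- Every point of `M` is a boundary point `incl z` or an interior point. [folklore] -/
theorem exists_incl_or_isInteriorPoint (a : M) :
    (∃ z, bM.incl z = a) ∨ (𝓡∂ (n + 1)).IsInteriorPoint a := by
  rcases (𝓡∂ (n + 1)).isInteriorPoint_or_isBoundaryPoint a with h | h
  · exact Or.inr h
  · left
    have h' : a ∈ (𝓡∂ (n + 1)).boundary M := h
    rw [← bM.range_incl] at h'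
    exact h'

omit [Nonempty bM.carrier] [IsManifold (𝓡∂ (n + 1)) ∞ N] in
/-- A seam point `inl (z, 0)` of `X` is not in the image of the interior of `M`. [folklore] -/
theorem inl_zero_ne_inr (z : bM.carrier) (x : InteriorManifold (𝓡∂ (n + 1)) M) :
    G.d₁.inl (z, 0) ≠ G.d₁.inr x := by
  intro h
  have h' := (G.d₁.inl_eq_inr_iff.1 h).1
  exact lt_irrefl (0 : ℝ) h'

/-- A point `inl x` of `P` coming from the interior of `M` is not in the image of the interior of
`N`. [folklore] -/
theorem inl_inr_ne_inr (x : InteriorManifold (𝓡∂ (n + 1)) M) (y : InteriorManifold (𝓡∂ (n + 1)) N) :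
    G.d₂.inl (G.d₁.inr x) ≠ G.d₂.inr y := by
  intro h
  have h1 := (G.d₂.inl_eq_inr_iff.1 h).1
  obtain ⟨p, hp, hpx⟩ := G.mem_glue₂_source_iff.1 h1
  have h2 : 0 < p.2 := (G.d₁.inl_eq_inr_iff.1 hpx).1
  linarith

/-- A seam point `inl (inl (z, 0))` of `P` is not in the image of the interior of `N`. [folklore] -/
theorem inl_inl_zero_ne_inr (z : bM.carrier) (y : InteriorManifold (𝓡∂ (n + 1)) N) :
    G.d₂.inl (G.d₁.inl (z, 0)) ≠ G.d₂.inr y := by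
  intro h
  have h1 := (G.d₂.inl_eq_inr_iff.1 h).1
  have h2 := G.inl_mem_glue₂_source_iff.1 h1
  exact lt_irrefl (0 : ℝ) h2

/-- **The fibre relation**: `j_M a = j_N c` iff `a = incl z` and `c = incl (φ z)` for some
`z ∈ ∂M` — the pieces meet exactly along `∂M ≡_φ ∂N`. [folklore] -/
theorem jM_eq_jN_iff {a : M} {c : N} :
    G.jM a = G.jN c ↔ ∃ z, a = bM.incl z ∧ c = bN.incl (G.φ z) := by
  constructor
  · intro h
    rcases exists_incl_or_isInteriorPoint (bM := bM) a with ⟨z, rfl⟩ | ha <;>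
      rcases exists_incl_or_isInteriorPoint (bM := bN) c with ⟨w, rfl⟩ | hc
    · rw [G.jM_incl, G.jN_incl] at h
      have h' : z = G.φ.symm w := (Prod.ext_iff.1 (G.d₁.inl_injective (G.d₂.inl_injective h))).1
      refine ⟨z, rfl, ?_⟩
      rw [h', Diffeomorph.apply_symm_apply]
    · rw [G.jM_incl, G.jN_of_isInteriorPoint hc] at h
      exact absurd h (G.inl_inl_zero_ne_inr z _)
    · rw [G.jM_of_isInteriorPoint ha, G.jN_incl] at h
      exact absurd (G.d₂.inl_injective h).symm (G.inl_zero_ne_inr _ _)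
    · rw [G.jM_of_isInteriorPoint ha, G.jN_of_isInteriorPoint hc] at h
      exact absurd h (G.inl_inr_ne_inr _ _)
  · rintro ⟨z, rfl, rfl⟩
    rw [G.jM_incl, G.jN_incl, Diffeomorph.symm_apply_apply]

/-- `j_M` is injective. [folklore] -/
theorem injective_jM : Injective G.jM := by
  intro a a' h
  rcases exists_incl_or_isInteriorPoint (bM := bM) a with ⟨z, rfl⟩ | ha <;>
    rcases exists_incl_or_isInteriorPoint (bM := bM) a' with ⟨z', rfl⟩ | ha'
  · rw [G.jM_incl, G.jM_incl] at h
    have h' : z = z' := (Prod.ext_iff.1 (G.d₁.inl_injective (G.d₂.inl_injective h))).1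
    rw [h']
  · rw [G.jM_incl, G.jM_of_isInteriorPoint ha'] at h
    exact absurd (G.d₂.inl_injective h) (G.inl_zero_ne_inr z _)
  · rw [G.jM_incl, G.jM_of_isInteriorPoint ha] at h
    exact absurd (G.d₂.inl_injective h).symm (G.inl_zero_ne_inr z' _)
  · rw [G.jM_of_isInteriorPoint ha, G.jM_of_isInteriorPoint ha'] at h
    exact congrArg InteriorManifold.val (G.d₁.inr_injective (G.d₂.inl_injective h))

/-- `j_N` is injective. [folklore] -/
theorem injective_jN : Injective G.jN := by
  intro c c' h
  rcases exists_incl_or_isInteriorPoint (bM := bN) c with ⟨w, rfl⟩ | hc <;>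
    rcases exists_incl_or_isInteriorPoint (bM := bN) c' with ⟨w', rfl⟩ | hc'
  · rw [G.jN_incl, G.jN_incl] at h
    have h' : G.φ.symm w = G.φ.symm w' :=
      (Prod.ext_iff.1 (G.d₁.inl_injective (G.d₂.inl_injective h))).1
    rw [G.φ.symm.injective h']
  · rw [G.jN_incl, G.jN_of_isInteriorPoint hc'] at h
    exact absurd h (G.inl_inl_zero_ne_inr _ _)
  · rw [G.jN_incl, G.jN_of_isInteriorPoint hc] at h
    exact absurd h.symm (G.inl_inl_zero_ne_inr _ _)
  · rw [G.jN_of_isInteriorPoint hc, G.jN_of_isInteriorPoint hc'] at h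
    exact congrArg InteriorManifold.val (G.d₂.inr_injective h)

/-- **The pieces cover `P`.** [folklore] -/
theorem range_jM_union_range_jN : range G.jM ∪ range G.jN = univ := by
  refine eq_univ_of_forall fun q => ?_
  obtain (⟨x, rfl⟩ | ⟨y, rfl⟩) := G.d₂.exists_inl_or_inr q
  · obtain (⟨⟨z, t⟩, rfl⟩ | ⟨a, rfl⟩) := G.d₁.exists_inl_or_inr x
    · rcases le_or_gt 0 t with ht | ht
      · exact Or.inl ⟨G.CM.toFun z t, G.jM_toFun z ht⟩
      · refine Or.inr ⟨G.CN.toFun (G.φ z) (-t), ?_⟩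
        rw [G.jN_toFun z (by linarith), neg_neg]
    · exact Or.inl ⟨a.val, G.jM_of_isInteriorPoint a.property⟩
  · exact Or.inr ⟨y.val, G.jN_of_isInteriorPoint y.property⟩

/-! ### Conclusion -/

/-- `P` is compact when `M` and `N` are (it is covered by the two continuous images). [folklore] -/
instance instCompactSpaceGlued₂ [CompactSpace M] [CompactSpace N] : CompactSpace G.d₂.Glued := by
  refine ⟨?_⟩
  rw [← G.range_jM_union_range_jN]
  exact (isCompact_range G.continuous_jM).union (isCompact_range G.continuous_jN)

/-- `P` is second countable when `M` and `N` are compact (a compact manifold over `ℝⁿ⁺¹`). [folklore] -/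
instance instSecondCountableGlued₂ [CompactSpace M] [CompactSpace N] :
    SecondCountableTopology G.d₂.Glued :=
  G.d₂.secondCountableTopology

/-- **`j_M` is a smooth embedding** (`M` compact, `M`, `N` Hausdorff): an injective immersion which
is a closed embedding as a continuous injection of a compact space into a Hausdorff space. [folklore] -/
theorem isSmoothEmbedding_jM [CompactSpace M] [T2Space M] [T2Space N] :
    Manifold.IsSmoothEmbedding (𝓡∂ (n + 1)) 𝓘(ℝ, 𝔼 (n + 1)) ∞ G.jM :=
  ⟨G.isImmersion_jM, (G.continuous_jM.isClosedEmbedding G.injective_jM).isEmbedding⟩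

/-- **`j_N` is a smooth embedding** (`N` compact, `M`, `N` Hausdorff). [folklore] -/
theorem isSmoothEmbedding_jN [CompactSpace N] [T2Space M] [T2Space N] :
    Manifold.IsSmoothEmbedding (𝓡∂ (n + 1)) 𝓘(ℝ, 𝔼 (n + 1)) ∞ G.jN :=
  ⟨G.isImmersion_jN, (G.continuous_jN.isClosedEmbedding G.injective_jN).isEmbedding⟩

/-- **The glued manifold is the gluing of `M` and `N` along `φ`** in the sense of
`Literature.Topology.FourManifolds.IsBoundaryGluing` (Milnor (1965), Thm. 1.4; Bröcker–Jänich (1982), (13.11);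
Hirsch (1976), Ch. 8 §2): `M` and `N` are smoothly embedded in `P = G.d₂.Glued`, cover it, and
meet exactly along `∂M ≡_φ ∂N`. [cite: BrockerJanich1982, (13.11)] -/
theorem isBoundaryGluing [CompactSpace M] [CompactSpace N] [T2Space M] [T2Space N] :
    IsBoundaryGluing bM bN G.φ (𝓡 (n + 1)) G.d₂.Glued :=
  ⟨G.jM, G.jN, G.isSmoothEmbedding_jM, G.isSmoothEmbedding_jN, G.range_jM_union_range_jN,
    fun _ _ => G.jM_eq_jN_iff⟩

end BoundaryGlueData

end Construction

/-! ### The case of an empty boundary: the disjoint union -/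

section EmptyBoundary

variable {n : ℕ} {M N : Type u} [TopologicalSpace M] [ChartedSpace (ℍ (n + 1)) M]
  [TopologicalSpace N] [ChartedSpace (ℍ (n + 1)) N]

/-- A manifold whose boundary datum has empty carrier consists of interior points. [folklore] -/
theorem BoundaryData.isInteriorPoint_of_isEmpty (b : BoundaryData (𝓡∂ (n + 1)) M (𝓡 n))
    [IsEmpty b.carrier] (a : M) : (𝓡∂ (n + 1)).IsInteriorPoint a := by
  rw [ModelWithCorners.isInteriorPoint_iff_not_isBoundaryPoint]
  intro h
  have h' : a ∈ (𝓡∂ (n + 1)).boundary M := h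
  rw [← b.range_incl] at h'
  obtain ⟨z, -⟩ := h'
  exact isEmptyElim z

/-- The first summand of `M ⊕ N` as points of the interior `(M ⊕ N) - ∂(M ⊕ N)`, when `M` has no
boundary points. [folklore] -/
def sumInlPt (hM : ∀ a : M, (𝓡∂ (n + 1)).IsInteriorPoint a) (a : M) :
    InteriorManifold (𝓡∂ (n + 1)) (M ⊕ N) :=
  ⟨Sum.inl a, ModelWithCorners.interiorPoint_inl a (hM a)⟩

/-- The second summand of `M ⊕ N` as points of the interior, when `N` has no boundary points.
[folklore] -/
def sumInrPt (hN : ∀ c : N, (𝓡∂ (n + 1)).IsInteriorPoint c) (c : N) :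
    InteriorManifold (𝓡∂ (n + 1)) (M ⊕ N) :=
  ⟨Sum.inr c, ModelWithCorners.interiorPoint_inr c (hN c)⟩

/-- `sumInlPt` has underlying point `inl a` (definitional). [folklore] -/
@[simp] theorem sumInlPt_val (hM : ∀ a : M, (𝓡∂ (n + 1)).IsInteriorPoint a) (a : M) :
    (sumInlPt (N := N) hM a).val = Sum.inl a := rfl

/-- `sumInrPt` has underlying point `inr c` (definitional). [folklore] -/
@[simp] theorem sumInrPt_val (hN : ∀ c : N, (𝓡∂ (n + 1)).IsInteriorPoint c) (c : N) :
    (sumInrPt (M := M) hN c).val = Sum.inr c := rfl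

/-- `sumInlPt` is injective. [folklore] -/
theorem injective_sumInlPt (hM : ∀ a : M, (𝓡∂ (n + 1)).IsInteriorPoint a) :
    Injective (sumInlPt (N := N) hM) := fun _ _ h =>
  Sum.inl_injective (congrArg InteriorManifold.val h)

/-- `sumInrPt` is injective. [folklore] -/
theorem injective_sumInrPt (hN : ∀ c : N, (𝓡∂ (n + 1)).IsInteriorPoint c) :
    Injective (sumInrPt (M := M) hN) := fun _ _ h =>
  Sum.inr_injective (congrArg InteriorManifold.val h)

/-- `sumInlPt` is continuous. [folklore] -/
theorem continuous_sumInlPt (hM : ∀ a : M, (𝓡∂ (n + 1)).IsInteriorPoint a) :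
    Continuous (sumInlPt (N := N) hM) :=
  InteriorManifold.continuous_iff_comp_val.2 continuous_inl

/-- `sumInrPt` is continuous. [folklore] -/
theorem continuous_sumInrPt (hN : ∀ c : N, (𝓡∂ (n + 1)).IsInteriorPoint c) :
    Continuous (sumInrPt (M := M) hN) :=
  InteriorManifold.continuous_iff_comp_val.2 continuous_inr

/-- The two summands cover the interior of `M ⊕ N`. [folklore] -/
theorem range_sumInlPt_union_range_sumInrPt (hM : ∀ a : M, (𝓡∂ (n + 1)).IsInteriorPoint a)
    (hN : ∀ c : N, (𝓡∂ (n + 1)).IsInteriorPoint c) :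
    range (sumInlPt (N := N) hM) ∪ range (sumInrPt (M := M) hN) = univ := by
  refine eq_univ_of_forall fun x => ?_
  obtain ⟨v, hv⟩ := x
  rcases v with a | c
  · exact Or.inl ⟨a, rfl⟩
  · exact Or.inr ⟨c, rfl⟩

variable [IsManifold (𝓡∂ (n + 1)) ∞ M] [IsManifold (𝓡∂ (n + 1)) ∞ N]

/-- **`sumInlPt : M → (M ⊕ N)°` is a `C^∞` immersion** at every point (complement `PUnit`): in the
charts `chartAt a` of `M` and `interiorChart` at `inl a` (the lift of `chartAt a` to the sum,
Mathlib's `ChartedSpace.sum_chartAt_inl`) it reads as the identity. [folklore] -/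
theorem isImmersionAtOfComplement_sumInlPt (hM : ∀ a : M, (𝓡∂ (n + 1)).IsInteriorPoint a)
    (a : M) : Manifold.IsImmersionAtOfComplement PUnit.{1} (𝓡∂ (n + 1)) 𝓘(ℝ, 𝔼 (n + 1)) ∞
      (sumInlPt (N := N) hM) a := by
  set e := chartAt (ℍ (n + 1)) a with he
  set x : InteriorManifold (𝓡∂ (n + 1)) (M ⊕ N) := sumInlPt hM a with hx
  have hchart : chartAt (ℍ (n + 1)) (Sum.inl a : M ⊕ N) =
      e.lift_openEmbedding IsOpenEmbedding.inl :=
    ChartedSpace.sum_chartAt_inl a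
  refine Manifold.IsImmersionAtOfComplement.mk_of_charts
    (ContinuousLinearEquiv.prodUnique ℝ _ PUnit) e (InteriorManifold.interiorChart x)
    (mem_chart_source _ a) ?_ (IsManifold.chart_mem_maximalAtlas a)
    (IsManifold.chart_mem_maximalAtlas (I := 𝓘(ℝ, 𝔼 (n + 1))) x) ?_ ?_
  · show Sum.inl a ∈ (chartAt (ℍ (n + 1)) (Sum.inl a : M ⊕ N)).source
    rw [hchart, OpenPartialHomeomorph.lift_openEmbedding_source]
    exact mem_image_of_mem _ (mem_chart_source _ a)
  · intro m hm
    show Sum.inl m ∈ (chartAt (ℍ (n + 1)) (Sum.inl a : M ⊕ N)).source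
    rw [hchart, OpenPartialHomeomorph.lift_openEmbedding_source]
    exact mem_image_of_mem _ hm
  · intro u hu
    have h1 : ((chartAt (ℍ (n + 1)) (Sum.inl a : M ⊕ N)).extend (𝓡∂ (n + 1)))
        (Sum.inl ((e.extend (𝓡∂ (n + 1))).symm u)) =
        (e.extend (𝓡∂ (n + 1))) ((e.extend (𝓡∂ (n + 1))).symm u) := by
      simp only [OpenPartialHomeomorph.extend_coe, OpenPartialHomeomorph.extend_coe_symm,
        comp_apply, sum_chartAt_inl_apply]
      rfl
    simp only [comp_apply, OpenPartialHomeomorph.extend_coe (I := 𝓘(ℝ, 𝔼 (n + 1))),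
      modelWithCornersSelf_coe, id_eq, InteriorManifold.interiorChart_apply,
      ContinuousLinearEquiv.prodUnique_apply]
    show ((chartAt (ℍ (n + 1)) (Sum.inl a : M ⊕ N)).extend (𝓡∂ (n + 1)))
        (Sum.inl ((e.extend (𝓡∂ (n + 1))).symm u)) = u
    rw [h1]
    exact (e.extend _).right_inv hu

/-- **`sumInrPt : N → (M ⊕ N)°` is a `C^∞` immersion** at every point. [folklore] -/
theorem isImmersionAtOfComplement_sumInrPt (hN : ∀ c : N, (𝓡∂ (n + 1)).IsInteriorPoint c)
    (c : N) : Manifold.IsImmersionAtOfComplement PUnit.{1} (𝓡∂ (n + 1)) 𝓘(ℝ, 𝔼 (n + 1)) ∞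
      (sumInrPt (M := M) hN) c := by
  set e := chartAt (ℍ (n + 1)) c with he
  set x : InteriorManifold (𝓡∂ (n + 1)) (M ⊕ N) := sumInrPt hN c with hx
  have hchart : chartAt (ℍ (n + 1)) (Sum.inr c : M ⊕ N) =
      e.lift_openEmbedding IsOpenEmbedding.inr :=
    ChartedSpace.sum_chartAt_inr c
  refine Manifold.IsImmersionAtOfComplement.mk_of_charts
    (ContinuousLinearEquiv.prodUnique ℝ _ PUnit) e (InteriorManifold.interiorChart x)
    (mem_chart_source _ c) ?_ (IsManifold.chart_mem_maximalAtlas c)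
    (IsManifold.chart_mem_maximalAtlas (I := 𝓘(ℝ, 𝔼 (n + 1))) x) ?_ ?_
  · show Sum.inr c ∈ (chartAt (ℍ (n + 1)) (Sum.inr c : M ⊕ N)).source
    rw [hchart, OpenPartialHomeomorph.lift_openEmbedding_source]
    exact mem_image_of_mem _ (mem_chart_source _ c)
  · intro m hm
    show Sum.inr m ∈ (chartAt (ℍ (n + 1)) (Sum.inr c : M ⊕ N)).source
    rw [hchart, OpenPartialHomeomorph.lift_openEmbedding_source]
    exact mem_image_of_mem _ hm
  · intro u hu
    have h1 : ((chartAt (ℍ (n + 1)) (Sum.inr c : M ⊕ N)).extend (𝓡∂ (n + 1)))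
        (Sum.inr ((e.extend (𝓡∂ (n + 1))).symm u)) =
        (e.extend (𝓡∂ (n + 1))) ((e.extend (𝓡∂ (n + 1))).symm u) := by
      simp only [OpenPartialHomeomorph.extend_coe, OpenPartialHomeomorph.extend_coe_symm,
        comp_apply, sum_chartAt_inr_apply]
      rfl
    simp only [comp_apply, OpenPartialHomeomorph.extend_coe (I := 𝓘(ℝ, 𝔼 (n + 1))),
      modelWithCornersSelf_coe, id_eq, InteriorManifold.interiorChart_apply,
      ContinuousLinearEquiv.prodUnique_apply]
    show ((chartAt (ℍ (n + 1)) (Sum.inr c : M ⊕ N)).extend (𝓡∂ (n + 1)))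
        (Sum.inr ((e.extend (𝓡∂ (n + 1))).symm u)) = u
    rw [h1]
    exact (e.extend _).right_inv hu

/-- **Gluing along an empty boundary is the disjoint union.** If the boundary data `bM`, `bN`
have empty carriers then the interior of `M ⊕ N` (which is all of `M ⊕ N`), a `C^∞` manifold
modelled on `ℝⁿ⁺¹`, is the gluing of `M` and `N` along the (empty) map `φ`, for `M`, `N` compact
Hausdorff. [folklore] -/
theorem isBoundaryGluing_interiorSum [CompactSpace M] [CompactSpace N] [T2Space M] [T2Space N]
    {bM : BoundaryData (𝓡∂ (n + 1)) M (𝓡 n)} {bN : BoundaryData (𝓡∂ (n + 1)) N (𝓡 n)}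
    [IsEmpty bM.carrier] [IsEmpty bN.carrier] (φ : bM.carrier → bN.carrier) :
    IsBoundaryGluing bM bN φ (𝓡 (n + 1)) (InteriorManifold (𝓡∂ (n + 1)) (M ⊕ N)) := by
  have hM := bM.isInteriorPoint_of_isEmpty
  have hN := bN.isInteriorPoint_of_isEmpty
  have himmM : Manifold.IsImmersion (𝓡∂ (n + 1)) 𝓘(ℝ, 𝔼 (n + 1)) ∞ (sumInlPt (N := N) hM) :=
    Manifold.IsImmersionOfComplement.isImmersion (F := PUnit.{1})
      fun a => isImmersionAtOfComplement_sumInlPt hM a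
  have himmN : Manifold.IsImmersion (𝓡∂ (n + 1)) 𝓘(ℝ, 𝔼 (n + 1)) ∞ (sumInrPt (M := M) hN) :=
    Manifold.IsImmersionOfComplement.isImmersion (F := PUnit.{1})
      fun c => isImmersionAtOfComplement_sumInrPt hN c
  refine ⟨sumInlPt hM, sumInrPt hN,
    ⟨himmM, ((continuous_sumInlPt hM).isClosedEmbedding (injective_sumInlPt hM)).isEmbedding⟩,
    ⟨himmN, ((continuous_sumInrPt hN).isClosedEmbedding (injective_sumInrPt hN)).isEmbedding⟩,
    range_sumInlPt_union_range_sumInrPt hM hN, fun a c => ?_⟩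
  constructor
  · intro h
    exact absurd (congrArg InteriorManifold.val h) Sum.inl_ne_inr
  · rintro ⟨z, -, -⟩
    exact isEmptyElim z

omit [IsManifold (𝓡∂ (n + 1)) ∞ M] [IsManifold (𝓡∂ (n + 1)) ∞ N] in
/-- The interior of `M ⊕ N` is compact when `M`, `N` are compact without boundary points. [folklore] -/
theorem compactSpace_interiorSum [CompactSpace M] [CompactSpace N]
    (hM : ∀ a : M, (𝓡∂ (n + 1)).IsInteriorPoint a) (hN : ∀ c : N, (𝓡∂ (n + 1)).IsInteriorPoint c) :
    CompactSpace (InteriorManifold (𝓡∂ (n + 1)) (M ⊕ N)) := by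
  refine ⟨?_⟩
  rw [← range_sumInlPt_union_range_sumInrPt hM hN]
  exact (isCompact_range (continuous_sumInlPt hM)).union (isCompact_range (continuous_sumInrPt hN))

end EmptyBoundary

end Literature.Topology.FourManifolds
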